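import Summits.CriticalPhenomena.PercolationContinuityZ3.Theorems.PercNearOneGluingNoHeavyLowerTailSahiTangentCoinCylinderSlots
import Summits.CriticalPhenomena.PercolationContinuityZ3.Theorems.PercNearOneGluingNoHeavyLowerTailSahiTangentSlotMonotone

/-!
# `NoHeavyLowerTail` (crux stmt-CriticalPhenomena-4575), Sahi programme: **THE CONTRACTION INEQUALITY FOR CYLINDER PAIRS AT EVERY ORDER** —
# `s · E_n^{μ}(1_{C(t_0)},…,1_{C(t_{n−1})}) ≤ E_n^{B_s⊗μ}(F_0,…,F_{n−1})`, `F_l = ε ? 1_{C(t_l)} : 1_{C(b_l)}`, `t_l ⊆ b_l`, every `n`, every cube, every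
# product measure (orders 3 and 4 were `sahiE_three_coin_cylinders_ge`, gen 48, and `sahiE_four_coin_cylinders_ge`, gen 49)

Support file (Sahi cell, seat `prim-sahi-p1`, generation 50; `--supports stmt-CriticalPhenomena-4575`).  Pure proofs, NO definitions, no `sorry`,
standard axioms.  Conjecture T₃ / its all-orders form `T_n` ("`p ↦ E_n^{B_p⊗μ}(F)/p` is non-increasing"; memo FROM-prim-sahi-p2-gen32-TANGENT) is thereby
a THEOREM for cylinder pairs on every cube `{0,1}^ι` with every product measure, at every order `n` — percolation reading: one more independent
edge `e`; for increasing events `A_l` whose sections `A_l|_{e open} = C(t_l)`, `A_l|_{e closed} = C(b_l)` are cylinders,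
`E_n(A_0,…,A_{n−1}) ≥ P(e open)·E_n(A_0,…,A_{n−1} | e open)`.

THE PROOF (memo FROM-prim-sahi-p1-gen49-PRINCIPAL-BOTTOM-TANGENT §A2/§A6 and the gen-50 memo), by strong induction on `n` and, inside, on `Σ_l |b_l|`:
* ERASURE (`sahiE_coin_pairs_erase_le`): if a defect coordinate `e ∈ b_k ∖ t_k` lies in another bottom `b_j`, erasing it from `b_k` can only
  DECREASE `E_n^{B_s⊗μ}(F)`: the proper mixed bottom-moments of slot `k` go up (`M` is antitone), the full one is unchanged (`e ∈ b_j`), and the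
  subfamilies avoiding `k` are cylinder-pair families of smaller size, nonnegative by the induction hypothesis — so the abstract antitonicity
  `SahiTangent.sahiE_update_le_of_moments` applies.  The tops, hence `E_n^{μ}(tops)`, are unchanged.
* FROZEN families (no such coordinate: `Disjoint (b_l ∖ t_l) (b_j)` for `j ≠ l`) ARE scalar families (`sahiE_coin_pairs_eq_scalar_of_frozen`) and
  scalar families satisfy the inequality by interpolation down to Theorem V (`sahiE_coin_scalar_ge`, `vtxD_nonneg`).
MAIN: `sahiE_coin_cSlot_pairs_ge` (family written with `cSlot t_l b_l 1`) and `sahiE_coin_cylinders_ge` (the explicit form of the order-3/4 files).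
Nothing conjectural is asserted. [this work]
-/

namespace Summit.CriticalPhenomena.PercolationContinuityZ3.Theorems.SahiTangentCyl

open Finset Function Literature.Combinatorics.Sahi2008
open Literature.Probability.Percolation.DecisionTree (ind ind_of_mem ind_of_not_mem ind_nonneg)
open scoped BigOperators

noncomputable section

variable {ι : Type*} [DecidableEq ι]

/-- Erasing from `A` an element of `B` does not change `A ∪ B`. [this work] -/
theorem erase_union_of_mem_right {A B : Finset ι} {e : ι} (h : e ∈ B) : A.erase e ∪ B = A ∪ B := by
  ext x
  simp only [mem_union, mem_erase]
  constructor
  · rintro (⟨_, hx⟩ | hx)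
    · exact Or.inl hx
    · exact Or.inr hx
  · rintro (hx | hx)
    · by_cases hxe : x = e
      · subst hxe; exact Or.inr h
      · exact Or.inl ⟨hxe, hx⟩
    · exact Or.inr hx

/-- An injection `Fin m → Fin n` that misses a point has `m < n`. [folklore] -/
theorem lt_of_injective_of_forall_ne {m n : ℕ} {φ : Fin m → Fin n} (hφ : Injective φ) {k : Fin n} (hk : ∀ i, φ i ≠ k) : m < n := by
  have h1 : (univ.image φ).card = m := by rw [Finset.card_image_of_injective _ hφ, Finset.card_univ, Fintype.card_fin]
  have h2 : univ.image φ ⊆ univ.erase k := fun x hx => by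
    obtain ⟨i, _, rfl⟩ := Finset.mem_image.1 hx
    exact Finset.mem_erase.2 ⟨hk i, Finset.mem_univ _⟩
  have h3 := Finset.card_le_card h2
  rw [Finset.card_erase_of_mem (Finset.mem_univ k), Finset.card_univ, Fintype.card_fin, h1] at h3
  have h4 := Fin.pos k
  omega

variable [Fintype ι]

/-- **ERASURE STEP.**  For a cylinder-pair family `cSlot t_l b_l 1` under `B_s ⊗ bernoulliWeight q` (`s ≤ 1`), a slot `k`, and a coordinate `e ∈ b_k` lying
in another bottom `b_j` (`j ≠ k`): erasing `e` from `b_k` does not increase `E_n` — provided every subfamily avoiding slot `k` has `E_m ≥ 0` (in the main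
induction: the theorem at smaller orders).  This is `SahiTangent.sahiE_update_le_of_moments` with the explicit moments `ex_cSlot`. [this work] -/
theorem sahiE_coin_pairs_erase_le (q : ι → unitInterval) {s : ℝ} (hs1 : s ≤ 1) {n : ℕ} (t b : Fin n → Finset ι) (k : Fin n) {e : ι}
    {j : Fin n} (hjk : j ≠ k) (hej : e ∈ b j)
    (hpos : ∀ (m : ℕ) (φ : Fin m → Fin n), Injective φ → (∀ i, φ i ≠ k) →
      0 ≤ sahiE (fun z : Bool × Set ι => if z.1 then s * bernoulliWeight q z.2 else (1 - s) * bernoulliWeight q z.2) m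
        (fun i => cSlot (t (φ i)) (b (φ i)) 1)) :
    sahiE (fun z : Bool × Set ι => if z.1 then s * bernoulliWeight q z.2 else (1 - s) * bernoulliWeight q z.2) n
        (fun l => cSlot (t l) (update b k ((b k).erase e) l) 1) ≤
      sahiE (fun z : Bool × Set ι => if z.1 then s * bernoulliWeight q z.2 else (1 - s) * bernoulliWeight q z.2) n
        (fun l => cSlot (t l) (b l) 1) := by
  set ν : Bool × Set ι → ℝ := fun z => if z.1 then s * bernoulliWeight q z.2 else (1 - s) * bernoulliWeight q z.2 with hν
  have hq0 : ∀ i, 0 ≤ ((q i : ℝ)) := fun i => (q i).2.1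
  have hq1 : ∀ i, ((q i : ℝ)) ≤ 1 := fun i => (q i).2.2
  have enew : update (fun l => cSlot (t l) (b l) 1) k (cSlot (t k) ((b k).erase e) 1) = fun l => cSlot (t l) (update b k ((b k).erase e) l) 1 := by
    funext l
    by_cases h : l = k
    · subst h; simp
    · simp [update_of_ne h]
  have eold : update (fun l => cSlot (t l) (b l) 1) k (cSlot (t k) (b k) 1) = fun l => cSlot (t l) (b l) 1 := by
    funext l
    by_cases h : l = k
    · subst h; simp
    · simp [update_of_ne h]
  have hprod : ∀ S : Finset (Fin n), ∏ l ∈ S, cSlot (t l) (b l) 1 = cSlot (S.biUnion t) (S.biUnion b) 1 := by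
    intro S
    have h := prod_cSlot t b (fun _ => (1 : ℝ)) S
    simp only [Finset.prod_const_one] at h
    exact h
  have key : sahiE ν n (update (fun l => cSlot (t l) (b l) 1) k (cSlot (t k) ((b k).erase e) 1)) ≤
      sahiE ν n (update (fun l => cSlot (t l) (b l) 1) k (cSlot (t k) (b k) 1)) := by
    refine SahiTangent.sahiE_update_le_of_moments ν n _ k (cSlot (t k) (b k) 1) (cSlot (t k) ((b k).erase e) 1) ?_ ?_ ?_
    · intro S hS
      rw [hprod, cSlot_mul, cSlot_mul, hν, ex_cSlot, ex_cSlot]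
      have hanti : cylMass (fun i => (q i : ℝ)) (b k ∪ S.biUnion b) ≤ cylMass (fun i => (q i : ℝ)) ((b k).erase e ∪ S.biUnion b) :=
        cylMass_anti hq0 hq1 (union_subset_union (erase_subset e (b k)) subset_rfl)
      have h1s : 0 ≤ 1 - s := sub_nonneg.2 hs1
      nlinarith [mul_le_mul_of_nonneg_left hanti h1s]
    · rw [hprod, cSlot_mul, cSlot_mul, hν, ex_cSlot, ex_cSlot]
      have hejS : e ∈ (univ.erase k).biUnion b := Finset.mem_biUnion.2 ⟨j, Finset.mem_erase.2 ⟨hjk, mem_univ j⟩, hej⟩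
      rw [erase_union_of_mem_right hejS]
    · intro m φ hφ hφk
      exact hpos m φ hφ hφk
  rw [enew, eold] at key
  exact key

/-- **THE CONTRACTION INEQUALITY FOR CYLINDER PAIRS AT EVERY ORDER** (family written with `cSlot`).  For every `n`, every finite `ι`, `q : ι → [0,1]`,
`s ∈ [0,1]` and cylinder pairs `t_l ⊆ b_l`:  `s · E_n^{μ}(1_{C(t_l)}) ≤ E_n^{B_s⊗μ}(cSlot t_l b_l 1)`, `μ = bernoulliWeight q`.  Strong induction on `n`
(positivity of the smaller pair families feeds the erasure step) and on `Σ_l |b_l|` (erasure until frozen; frozen = scalar family; interpolation to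
Theorem V). [this work] -/
theorem sahiE_coin_cSlot_pairs_ge (q : ι → unitInterval) {s : ℝ} (hs0 : 0 ≤ s) (hs1 : s ≤ 1) :
    ∀ (n : ℕ) (t b : Fin n → Finset ι), (∀ l, t l ⊆ b l) →
      s * sahiE (bernoulliWeight q) n (fun l (ω : Set ι) => ind {ω : Set ι | (t l : Set ι) ⊆ ω} ω) ≤
        sahiE (fun z : Bool × Set ι => if z.1 then s * bernoulliWeight q z.2 else (1 - s) * bernoulliWeight q z.2) n
          (fun l => cSlot (t l) (b l) 1) := by
  have hq0 : ∀ i, 0 ≤ ((q i : ℝ)) := fun i => (q i).2.1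
  have hq1 : ∀ i, ((q i : ℝ)) ≤ 1 := fun i => (q i).2.2
  intro n
  induction n using Nat.strong_induction_on with
  | _ n ihn =>
    -- inner induction on the total size of the bottoms
    suffices h : ∀ (N : ℕ) (t b : Fin n → Finset ι), ∑ l, (b l).card = N → (∀ l, t l ⊆ b l) →
        s * sahiE (bernoulliWeight q) n (fun l (ω : Set ι) => ind {ω : Set ι | (t l : Set ι) ⊆ ω} ω) ≤
          sahiE (fun z : Bool × Set ι => if z.1 then s * bernoulliWeight q z.2 else (1 - s) * bernoulliWeight q z.2) n
            (fun l => cSlot (t l) (b l) 1) from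
      fun t b htb => h _ t b rfl htb
    intro N
    induction N using Nat.strong_induction_on with
    | _ N ihN =>
      intro t b hN htb
      by_cases hfr : ∀ l j, l ≠ j → Disjoint (b l \ t l) (b j)
      · -- frozen: a scalar family
        rw [sahiE_coin_pairs_eq_scalar_of_frozen q s t b htb hfr]
        exact sahiE_coin_scalar_ge q hs0 hs1 t _ (fun l => cylMass_nonneg hq0 _) (fun l => cylMass_le_one hq0 hq1 _)
      · -- an erasable coordinate
        push Not at hfr
        obtain ⟨k, j, hkj, hdis⟩ := hfr
        obtain ⟨e, hek, hej⟩ := Finset.not_disjoint_iff.1 hdis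
        have hekb : e ∈ b k := (Finset.mem_sdiff.1 hek).1
        have hekt : e ∉ t k := (Finset.mem_sdiff.1 hek).2
        -- the erased family
        set b' : Fin n → Finset ι := update b k ((b k).erase e) with hb'
        have htb' : ∀ l, t l ⊆ b' l := by
          intro l
          by_cases hl : l = k
          · subst hl
            rw [hb', update_self]
            exact fun x hx => Finset.mem_erase.2 ⟨fun h => hekt (h ▸ hx), htb l hx⟩
          · rw [hb', update_of_ne hl]; exact htb l
        have hN' : ∑ l, (b' l).card < N := by
          rw [← hN]
          apply Finset.sum_lt_sum
          · intro l _
            by_cases hl : l = k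
            · subst hl; rw [hb', update_self]; exact Finset.card_le_card (erase_subset e (b l))
            · rw [hb', update_of_ne hl]
          · exact ⟨k, mem_univ k, by rw [hb', update_self]; exact Finset.card_erase_lt_of_mem hekb⟩
        have step1 := ihN _ hN' t b' rfl htb'
        have step2 : sahiE (fun z : Bool × Set ι => if z.1 then s * bernoulliWeight q z.2 else (1 - s) * bernoulliWeight q z.2) n
              (fun l => cSlot (t l) (b' l) 1) ≤
            sahiE (fun z : Bool × Set ι => if z.1 then s * bernoulliWeight q z.2 else (1 - s) * bernoulliWeight q z.2) n
              (fun l => cSlot (t l) (b l) 1) := by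
          refine sahiE_coin_pairs_erase_le q hs1 t b k hkj.symm hej fun m φ hφ hφk => ?_
          have hm : m < n := lt_of_injective_of_forall_ne hφ hφk
          have h := ihn m hm (fun i => t (φ i)) (fun i => b (φ i)) (fun i => htb (φ i))
          exact le_trans (mul_nonneg hs0 (sahiE_cyl_nonneg q fun i => t (φ i))) h
        exact le_trans step1 step2

/-- **THE CONTRACTION INEQUALITY FOR CYLINDER PAIRS ON A CUBE, EVERY ORDER** (the explicit form of `sahiE_three_coin_cylinders_ge` /
`sahiE_four_coin_cylinders_ge`, now for all `n`).  For the product measure `μ = bernoulliWeight q` on `Set ι`, a coin `s ∈ [0,1]`, and cylinder pairs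
`t_l ⊆ b_l` (`l < n`):  `s · E_n^{μ}(1_{C(t_0)},…,1_{C(t_{n−1})}) ≤ E_n^{B_s⊗μ}(F_0,…,F_{n−1})`, `F_l(ε, ω) = ε ? 1_{C(t_l)} ω : 1_{C(b_l)} ω`.  Equivalently
`s ↦ E_n^{B_s⊗μ}(F)/s` is non-increasing on `(0,1]`: Conjecture `T_n` holds for cylinder pairs on every cube, at every order. [this work] -/
theorem sahiE_coin_cylinders_ge (q : ι → unitInterval) {s : ℝ} (hs0 : 0 ≤ s) (hs1 : s ≤ 1) {n : ℕ} {t b : Fin n → Finset ι}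
    (htb : ∀ l, t l ⊆ b l) :
    s * sahiE (bernoulliWeight q) n (fun l (ω : Set ι) => ind {ω : Set ι | (t l : Set ι) ⊆ ω} ω) ≤
      sahiE (fun z : Bool × Set ι => if z.1 then s * bernoulliWeight q z.2 else (1 - s) * bernoulliWeight q z.2) n
        (fun l (z : Bool × Set ι) => if z.1 then ind {ω : Set ι | (t l : Set ι) ⊆ ω} z.2 else ind {ω : Set ι | (b l : Set ι) ⊆ ω} z.2) := by
  have e : (fun l (z : Bool × Set ι) => if z.1 then ind {ω : Set ι | (t l : Set ι) ⊆ ω} z.2 else ind {ω : Set ι | (b l : Set ι) ⊆ ω} z.2)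
      = fun l => cSlot (t l) (b l) 1 := by
    funext l; exact cSlot_one_eq_pair (t l) (b l)
  rw [e]
  exact sahiE_coin_cSlot_pairs_ge q hs0 hs1 n t b htb

end

end Summit.CriticalPhenomena.PercolationContinuityZ3.Theorems.SahiTangentCyl
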